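import Mathlib
import Literature.Analysis.ODE.RegularSingularAnalyticBranchSolution
import Summits.AtomisticToContinuum.HydrodynamicLimit.Theorems.ImplosionDichotomyDenseExcursionSonicCavityDefsB

/-!
# The analytic solution of a `2 × 2` system `z v′ = E(z) v` with holomorphic `E`, `E(0) = [[ν, β], [0, 0]]`, `Im ν ≠ 0`
# (crux `DenseExcursion`, line `sonic-cavity-renewal` v6, brick (M3a, part 2) for the registered helper `sonicSlaving_of_tube`)

Helper file (`--supports stmt-AtomisticToContinuum-12586`, line lead a2, stub-worker W2 for `sonicSlaving_of_tube`).

The classical form of the non-resonant Frobenius theorem of `Literature.Analysis.ODE.RegularSingularAnalyticBranchSolution`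
(`IsFrobeniusData.analyticBranch`: coefficient SEQUENCES with geometric bounds) for the shape the mode system has at the repulsive
sonic point in characteristic variables: four entries `e₁₁, e₁₂, e₂₁, e₂₂ : ℂ → ℂ` ANALYTIC AT `0` (as functions), the second row
vanishing at `0` (the `m`-equation is regular) and `Im e₁₁(0) ≠ 0` (`e₁₁(0) = ν(Λ) = (b₊₊(0) − Λ)/κ`, `Im ν = −Im Λ/κ`).

* `exists_coeff_of_analyticAt`: Cauchy estimates — an analytic germ at `0` is `Σ zⁿ • cₙ` on a ball with `‖cₙ‖ ≤ C aⁿ`, `c₀ = f 0`;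
* `opNorm_le_of_apply_two` (norm of a `2 × 2` action on `ℂ × ℂ`), `natCast_le_mul_norm_sub` (`n ≤ (2 + 2‖ν‖/|Im ν|)‖n − ν‖`),
  `norm_fuchsianInverse_le`, `fuchsianInverse_rightInverse` (the explicit inverse `[[1/(n−ν), β/(n(n−ν))],[0, 1/n]]` of `n − E(0)`,
  stated through its action so that the file has no definitions);
* `fuchsian2_analytic_solution` (registered helper): for every `m₀` there are `δ > 0` and `V : ℂ → ℂ × ℂ` holomorphic on `‖z‖ < δ`
  with `V 0 = (−(e₁₂ 0/e₁₁ 0) m₀, m₀)` and `z • V′(z) = E(z) V(z)` there.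

NOT here: the specialisation to the mode system (`…SonicSlavingAnalyticBranch`). No citation is load-bearing (the cited Frobenius
theorem is the proved Literature item).
-/

noncomputable section

open Set Filter Metric
open scoped Topology NNReal ENNReal

namespace Summit.AtomisticToContinuum.HydrodynamicLimit.Theorems.SonicCavityRenewal

open Literature.Analysis.ODE

/-! ## Cauchy estimates for an analytic germ -/

/-- CAUCHY ESTIMATES: a function analytic at `0` is, on some ball `‖z‖ < ρ`, the sum `Σ zⁿ • cₙ` of a coefficient sequence with a
geometric bound `‖cₙ‖ ≤ C aⁿ` and `c₀ = f 0`. [folklore] -/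
theorem exists_coeff_of_analyticAt {f : ℂ → ℂ} (hf : AnalyticAt ℂ f 0) :
    ∃ (c : ℕ → ℂ) (C a ρ : ℝ), 0 < ρ ∧ 0 ≤ a ∧ 0 ≤ C ∧ (∀ n, ‖c n‖ ≤ C * a ^ n) ∧ c 0 = f 0 ∧
      ∀ z : ℂ, ‖z‖ < ρ → HasSum (fun n => z ^ n • c n) (f z) := by
  obtain ⟨p, R, hp⟩ : ∃ (p : FormalMultilinearSeries ℂ ℂ ℂ) (R : ℝ≥0∞), HasFPowerSeriesOnBall f p 0 R :=
    let ⟨p, R, hR⟩ := hf; ⟨p, R, hR⟩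
  obtain ⟨r, hr0, hrR⟩ := ENNReal.lt_iff_exists_nnreal_btwn.1 hp.r_pos
  have hr0' : (0 : ℝ) < r := by exact_mod_cast hr0
  obtain ⟨C, hC0, hC⟩ := p.norm_mul_pow_le_of_lt_radius (hrR.trans_le hp.r_le)
  refine ⟨p.coeff, C, (r : ℝ)⁻¹, r, hr0', by positivity, hC0.le, fun n => ?_, ?_, fun z hz => ?_⟩
  · rw [← FormalMultilinearSeries.norm_apply_eq_norm_coef, inv_pow, ← div_eq_mul_inv, le_div_iff₀ (pow_pos hr0' n)]
    exact hC n
  · exact hp.hasFPowerSeriesAt.coeff_zero 1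
  · have hz' : z ∈ Metric.eball (0 : ℂ) R := by
      rw [Metric.mem_eball, edist_zero_right]
      calc (‖z‖₊ : ℝ≥0∞) < r := by exact_mod_cast hz
        _ < R := hrR
    have h := hp.hasSum hz'
    rw [zero_add] at h
    simpa only [FormalMultilinearSeries.apply_eq_pow_smul_coeff] using h

/-! ## The coefficient matrices and the explicit inverse of `n − E(0)` (as actions on `ℂ × ℂ`) -/

/-- Norm of a `2 × 2` matrix acting on `ℂ × ℂ` (sup norm): `‖T‖ ≤ 2K` if all four entries have norm `≤ K`. [folklore] -/
theorem opNorm_le_of_apply_two {T : ℂ × ℂ →L[ℂ] ℂ × ℂ} {s t s' t' : ℂ} {K : ℝ} (hK : 0 ≤ K)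
    (hT : ∀ v, T v = (s * v.1 + t * v.2, s' * v.1 + t' * v.2)) (hs : ‖s‖ ≤ K) (ht : ‖t‖ ≤ K) (hs' : ‖s'‖ ≤ K)
    (ht' : ‖t'‖ ≤ K) : ‖T‖ ≤ 2 * K := by
  refine ContinuousLinearMap.opNorm_le_bound _ (by positivity) fun v => ?_
  have hv1 : ‖v.1‖ ≤ ‖v‖ := norm_fst_le v
  have hv2 : ‖v.2‖ ≤ ‖v‖ := norm_snd_le v
  have row : ∀ a b : ℂ, ‖a‖ ≤ K → ‖b‖ ≤ K → ‖a * v.1 + b * v.2‖ ≤ 2 * K * ‖v‖ := by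
    intro a b ha hb
    calc ‖a * v.1 + b * v.2‖ ≤ ‖a‖ * ‖v.1‖ + ‖b‖ * ‖v.2‖ := by
          refine (norm_add_le _ _).trans ?_
          rw [norm_mul, norm_mul]
      _ ≤ K * ‖v‖ + K * ‖v‖ :=
          add_le_add (mul_le_mul ha hv1 (norm_nonneg _) hK) (mul_le_mul hb hv2 (norm_nonneg _) hK)
      _ = 2 * K * ‖v‖ := by ring
  rw [hT v, Prod.norm_mk, max_le_iff]
  exact ⟨row _ _ hs ht, row _ _ hs' ht'⟩

/-- NON-RESONANCE, QUANTIFIED: if `Im ν ≠ 0` then `n ≤ (2 + 2‖ν‖/|Im ν|)·‖n − ν‖` for every `n : ℕ` (for `n ≤ 2‖ν‖` use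
`‖n − ν‖ ≥ |Im ν|`, otherwise `‖n − ν‖ ≥ n − ‖ν‖ ≥ n/2`). [folklore] -/
theorem natCast_le_mul_norm_sub {ν : ℂ} (hν : ν.im ≠ 0) (n : ℕ) :
    (n : ℝ) ≤ (2 + 2 * ‖ν‖ / |ν.im|) * ‖(n : ℂ) - ν‖ := by
  have hι : 0 < |ν.im| := abs_pos.2 hν
  have him : |ν.im| ≤ ‖(n : ℂ) - ν‖ := by
    have h := Complex.abs_im_le_norm ((n : ℂ) - ν)
    rwa [Complex.sub_im, Complex.natCast_im, zero_sub, abs_neg] at h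
  have hre : (n : ℝ) - ‖ν‖ ≤ ‖(n : ℂ) - ν‖ := by
    have h := norm_sub_norm_le (n : ℂ) ν
    rwa [Complex.norm_natCast] at h
  have hn0 : 0 ≤ ‖ν‖ := norm_nonneg ν
  have hq : 0 ≤ 2 * ‖ν‖ / |ν.im| := by positivity
  rcases le_or_gt (n : ℝ) (2 * ‖ν‖) with h | h
  · calc (n : ℝ) ≤ 2 * ‖ν‖ := h
      _ = 2 * ‖ν‖ / |ν.im| * |ν.im| := by field_simp
      _ ≤ 2 * ‖ν‖ / |ν.im| * ‖(n : ℂ) - ν‖ := mul_le_mul_of_nonneg_left him hq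
      _ ≤ (2 + 2 * ‖ν‖ / |ν.im|) * ‖(n : ℂ) - ν‖ := by nlinarith [norm_nonneg ((n : ℂ) - ν)]
  · nlinarith [norm_nonneg ((n : ℂ) - ν)]

/-- `n − ν ≠ 0` for `n : ℕ` when `Im ν ≠ 0`. [folklore] -/
theorem natCast_sub_ne_zero {ν : ℂ} (hν : ν.im ≠ 0) (n : ℕ) : (n : ℂ) - ν ≠ 0 := by
  intro h
  have := congrArg Complex.im h
  rw [Complex.sub_im, Complex.natCast_im, Complex.zero_im, zero_sub, neg_eq_zero] at this
  exact hν this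

/-- THE EXPLICIT INVERSE `Rₙ = [[1/(n−ν), β/(n(n−ν))], [0, 1/n]]` of `n − E(0)`, `E(0) = [[ν, β], [0, 0]]`, has `‖Rₙ‖ ≤ c/n` with
`c = (2 + 2‖ν‖/|Im ν|)(1 + ‖β‖) + 1` (`n ≥ 1`, `Im ν ≠ 0`). [folklore] -/
theorem norm_fuchsianInverse_le {ν β : ℂ} (hν : ν.im ≠ 0) {n : ℕ} (hn : 1 ≤ n) {Rn : ℂ × ℂ →L[ℂ] ℂ × ℂ}
    (hR : ∀ w, Rn w = (((n : ℂ) - ν)⁻¹ * w.1 + β / ((n : ℂ) * ((n : ℂ) - ν)) * w.2, ((n : ℂ))⁻¹ * w.2)) :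
    ‖Rn‖ ≤ ((2 + 2 * ‖ν‖ / |ν.im|) * (1 + ‖β‖) + 1) / n := by
  set c₁ : ℝ := 2 + 2 * ‖ν‖ / |ν.im| with hc₁
  have hι : 0 < |ν.im| := abs_pos.2 hν
  have hc₁0 : 0 ≤ c₁ := by rw [hc₁]; positivity
  have hn0 : (0 : ℝ) < n := by exact_mod_cast hn
  have hn1 : (1 : ℝ) ≤ n := by exact_mod_cast hn
  have hnorm : 0 < ‖(n : ℂ) - ν‖ := norm_pos_iff.2 (natCast_sub_ne_zero hν n)
  have key : (n : ℝ) ≤ c₁ * ‖(n : ℂ) - ν‖ := natCast_le_mul_norm_sub hν n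
  have hinv : ‖((n : ℂ) - ν)⁻¹‖ ≤ c₁ / n := by
    rw [norm_inv, inv_eq_one_div, div_le_div_iff₀ hnorm hn0, one_mul]
    exact key
  have hinv' : ‖((n : ℂ) - ν)⁻¹‖ ≤ c₁ := hinv.trans (div_le_self hc₁0 hn1)
  have hβ : ‖β / ((n : ℂ) * ((n : ℂ) - ν))‖ ≤ ‖β‖ * c₁ / n := by
    rw [norm_div, norm_mul, Complex.norm_natCast, div_eq_mul_inv, mul_inv, ← norm_inv]
    calc ‖β‖ * ((n : ℝ)⁻¹ * ‖((n : ℂ) - ν)⁻¹‖) ≤ ‖β‖ * ((n : ℝ)⁻¹ * c₁) := by gcongr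
      _ = ‖β‖ * c₁ / n := by ring
  have hn' : ‖((n : ℂ))⁻¹‖ = (n : ℝ)⁻¹ := by rw [norm_inv, Complex.norm_natCast]
  refine ContinuousLinearMap.opNorm_le_bound _ (by positivity) fun w => ?_
  have hw1 : ‖w.1‖ ≤ ‖w‖ := norm_fst_le w
  have hw2 : ‖w.2‖ ≤ ‖w‖ := norm_snd_le w
  rw [hR w, Prod.norm_mk, max_le_iff]
  constructor
  · calc ‖((n : ℂ) - ν)⁻¹ * w.1 + β / ((n : ℂ) * ((n : ℂ) - ν)) * w.2‖
        ≤ ‖((n : ℂ) - ν)⁻¹‖ * ‖w.1‖ + ‖β / ((n : ℂ) * ((n : ℂ) - ν))‖ * ‖w.2‖ := by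
          refine (norm_add_le _ _).trans ?_
          rw [norm_mul, norm_mul]
      _ ≤ c₁ / n * ‖w‖ + ‖β‖ * c₁ / n * ‖w‖ :=
          add_le_add (mul_le_mul hinv hw1 (norm_nonneg _) (by positivity))
            (mul_le_mul hβ hw2 (norm_nonneg _) (by positivity))
      _ = (c₁ * (1 + ‖β‖)) / n * ‖w‖ := by ring
      _ ≤ (c₁ * (1 + ‖β‖) + 1) / n * ‖w‖ := by gcongr; linarith
  · calc ‖((n : ℂ))⁻¹ * w.2‖ = (n : ℝ)⁻¹ * ‖w.2‖ := by rw [norm_mul, hn']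
      _ ≤ (n : ℝ)⁻¹ * ‖w‖ := mul_le_mul_of_nonneg_left hw2 (by positivity)
      _ ≤ (c₁ * (1 + ‖β‖) + 1) / n * ‖w‖ := by
          rw [inv_eq_one_div]
          refine mul_le_mul_of_nonneg_right (div_le_div_of_nonneg_right ?_ hn0.le) (norm_nonneg _)
          nlinarith [norm_nonneg β]

/-- `Rₙ` is a right inverse of `n − E(0)` (`n ≥ 1`, `Im ν ≠ 0`), `E(0) = [[ν, β], [0, 0]]`. [folklore] -/
theorem fuchsianInverse_rightInverse {ν β : ℂ} (hν : ν.im ≠ 0) {n : ℕ} (hn : 1 ≤ n) {Rn E₀ : ℂ × ℂ →L[ℂ] ℂ × ℂ}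
    (hR : ∀ w, Rn w = (((n : ℂ) - ν)⁻¹ * w.1 + β / ((n : ℂ) * ((n : ℂ) - ν)) * w.2, ((n : ℂ))⁻¹ * w.2))
    (hE : ∀ v, E₀ v = (ν * v.1 + β * v.2, 0 * v.1 + 0 * v.2)) (w : ℂ × ℂ) : (n : ℂ) • Rn w - E₀ (Rn w) = w := by
  have hsub : (n : ℂ) - ν ≠ 0 := natCast_sub_ne_zero hν n
  have hn0 : (n : ℂ) ≠ 0 := Nat.cast_ne_zero.2 (by omega)
  rw [hE, hR]
  refine Prod.ext ?_ ?_
  · simp only [Prod.smul_mk, smul_eq_mul, Prod.fst_sub]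
    field_simp
    ring
  · simp only [Prod.smul_mk, smul_eq_mul, Prod.snd_sub]
    field_simp
    ring

/-! ## The analytic solution -/

/-- **THE ANALYTIC SOLUTION OF `z v′ = E(z) v` AT A NON-RESONANT SINGULARITY OF THE FIRST KIND (`2 × 2`, second row of `E(0)` zero,
`Im E₁₁(0) ≠ 0`)** — registered helper `fuchsian2_analytic_solution` for `sonicSlaving_of_tube`. For entries `e₁₁, e₁₂, e₂₁, e₂₂`
analytic at `0` with `e₂₁ 0 = e₂₂ 0 = 0` and `Im (e₁₁ 0) ≠ 0`, and every `m₀ : ℂ`, there are `δ > 0` and `V : ℂ → ℂ × ℂ` holomorphic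
on `‖z‖ < δ` with `V 0 = (−(e₁₂ 0 / e₁₁ 0) m₀, m₀)` and `z • V′(z) = (e₁₁ V₁ + e₁₂ V₂, e₂₁ V₁ + e₂₂ V₂)(z)` on `‖z‖ < δ`: the Frobenius
series of `IsFrobeniusData.analyticBranch` for the coefficient matrices of the entries (Cauchy estimates) and the explicit inverses
`fuchsianInverse (e₁₁ 0) (e₁₂ 0) n`, `‖Rₙ‖ ≤ c/n`. [cite: CoddingtonLevinson1955, Ch. 4] -/
theorem fuchsian2_analytic_solution : ∀ (e₁₁ e₁₂ e₂₁ e₂₂ : ℂ → ℂ), AnalyticAt ℂ e₁₁ 0 → AnalyticAt ℂ e₁₂ 0 → AnalyticAt ℂ e₂₁ 0 → AnalyticAt ℂ e₂₂ 0 → e₂₁ 0 = 0 → e₂₂ 0 = 0 → (e₁₁ 0).im ≠ 0 → ∀ m₀ : ℂ, ∃ δ : ℝ, 0 < δ ∧ ∃ V : ℂ → ℂ × ℂ, DifferentiableOn ℂ V (Metric.ball 0 δ) ∧ V 0 = (-(e₁₂ 0 / e₁₁ 0) * m₀, m₀) ∧ ∀ z ∈ Metric.ball 0 δ, z • deriv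 V z = (e₁₁ z * (V z).1 + e₁₂ z * (V z).2, e₂₁ z * (V z).1 + e₂₂ z * (V z).2) := by
  intro e₁₁ e₁₂ e₂₁ e₂₂ h₁₁ h₁₂ h₂₁ h₂₂ hz₂₁ hz₂₂ hν m₀
  -- coefficients of the four entries, common constants
  obtain ⟨c₁₁, C₁, a₁, ρ₁, hρ₁, ha₁, hC₁, hb₁, hc₁, hs₁⟩ := exists_coeff_of_analyticAt h₁₁
  obtain ⟨c₁₂, C₂, a₂, ρ₂, hρ₂, ha₂, hC₂, hb₂, hc₂, hs₂⟩ := exists_coeff_of_analyticAt h₁₂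
  obtain ⟨c₂₁, C₃, a₃, ρ₃, hρ₃, ha₃, hC₃, hb₃, hc₃, hs₃⟩ := exists_coeff_of_analyticAt h₂₁
  obtain ⟨c₂₂, C₄, a₄, ρ₄, hρ₄, ha₄, hC₄, hb₄, hc₄, hs₄⟩ := exists_coeff_of_analyticAt h₂₂
  set a : ℝ := max (max a₁ a₂) (max a₃ a₄) with ha
  set C : ℝ := max (max C₁ C₂) (max C₃ C₄) with hC
  set ρ : ℝ := min (min ρ₁ ρ₂) (min ρ₃ ρ₄) with hρ
  have ha0 : 0 ≤ a := le_max_of_le_left (le_max_of_le_left ha₁)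
  have hC0 : 0 ≤ C := le_max_of_le_left (le_max_of_le_left hC₁)
  have hρ0 : 0 < ρ := lt_min (lt_min hρ₁ hρ₂) (lt_min hρ₃ hρ₄)
  have mono : ∀ {c : ℕ → ℂ} {C' a' : ℝ}, 0 ≤ C' → 0 ≤ a' → C' ≤ C → a' ≤ a → (∀ n, ‖c n‖ ≤ C' * a' ^ n) →
      ∀ n, ‖c n‖ ≤ C * a ^ n := fun hC' ha' hCC haa h n =>
    (h n).trans (mul_le_mul hCC (pow_le_pow_left₀ ha' haa n) (pow_nonneg ha' n) hC0)
  have hb₁' := mono hC₁ ha₁ (le_max_of_le_left (le_max_left _ _)) (le_max_of_le_left (le_max_left _ _)) hb₁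
  have hb₂' := mono hC₂ ha₂ (le_max_of_le_left (le_max_right _ _)) (le_max_of_le_left (le_max_right _ _)) hb₂
  have hb₃' := mono hC₃ ha₃ (le_max_of_le_right (le_max_left _ _)) (le_max_of_le_right (le_max_left _ _)) hb₃
  have hb₄' := mono hC₄ ha₄ (le_max_of_le_right (le_max_right _ _)) (le_max_of_le_right (le_max_right _ _)) hb₄
  -- the Frobenius data
  set ν : ℂ := e₁₁ 0 with hνdef
  set β : ℂ := e₁₂ 0 with hβdef
  set M : ℕ → ℂ × ℂ →L[ℂ] ℂ × ℂ := fun n =>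
    (c₁₁ n • ContinuousLinearMap.fst ℂ ℂ ℂ + c₁₂ n • ContinuousLinearMap.snd ℂ ℂ ℂ).prod
      (c₂₁ n • ContinuousLinearMap.fst ℂ ℂ ℂ + c₂₂ n • ContinuousLinearMap.snd ℂ ℂ ℂ) with hM
  have hMv : ∀ n v, M n v = (c₁₁ n * v.1 + c₁₂ n * v.2, c₂₁ n * v.1 + c₂₂ n * v.2) := fun n v => by simp [hM]
  set R : ℕ → ℂ × ℂ →L[ℂ] ℂ × ℂ := fun n =>
    (((n : ℂ) - ν)⁻¹ • ContinuousLinearMap.fst ℂ ℂ ℂ + (β / ((n : ℂ) * ((n : ℂ) - ν))) • ContinuousLinearMap.snd ℂ ℂ ℂ).prod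
      (((n : ℂ))⁻¹ • ContinuousLinearMap.snd ℂ ℂ ℂ) with hR
  have hRw : ∀ n w, R n w = (((n : ℂ) - ν)⁻¹ * w.1 + β / ((n : ℂ) * ((n : ℂ) - ν)) * w.2, ((n : ℂ))⁻¹ * w.2) :=
    fun n w => by simp [hR]
  have hMnorm : ∀ n, ‖M n‖ ≤ 2 * C * a ^ n := fun n => by
    have h := opNorm_le_of_apply_two (by positivity : 0 ≤ C * a ^ n) (hMv n) (hb₁' n) (hb₂' n) (hb₃' n) (hb₄' n)
    linarith
  set cR : ℝ := (2 + 2 * ‖ν‖ / |ν.im|) * (1 + ‖β‖) + 1 with hcR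
  have hcR0 : 0 ≤ cR := by rw [hcR]; positivity
  set v₀ : ℂ × ℂ := (-(β / ν) * m₀, m₀) with hv₀
  have hν0 : ν ≠ 0 := fun h => hν (by rw [h, Complex.zero_im])
  have hF : IsFrobeniusData (𝕜 := ℂ) M (fun _ => 0) R v₀ a (2 * C) 0 cR :=
    { a_nonneg := ha0
      K_nonneg := by positivity
      G_nonneg := le_rfl
      c_nonneg := hcR0
      norm_M_le := fun k _ => hMnorm k
      norm_g_le := fun k _ => by rw [norm_zero, zero_mul]
      rightInverse := fun n hn w => fuchsianInverse_rightInverse hν hn (hRw n) (fun v => by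
        rw [hMv 0 v, hc₁, hc₂, hc₃, hc₄, hz₂₁, hz₂₂]) w
      norm_R_le := fun n hn => norm_fuchsianInverse_le hν hn (hRw n)
      compat := by
        rw [add_zero, hMv, hc₁, hc₂, hc₃, hc₄, hz₂₁, hz₂₂, hv₀]
        ext
        · simp only [Prod.fst_zero]
          field_simp
          ring
        · simp only [Prod.snd_zero]
          ring }
  obtain ⟨hV0, hcoeff, hball, -⟩ := hF.analyticBranch
  -- the radius
  set lam : ℝ := a * (1 + 2 * cR * (2 * C)) with hlam
  have hlam0 : 0 ≤ lam := hF.a_le_lam.1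
  set δ : ℝ := min ρ (1 / (lam + 1)) with hδ
  have hδ0 : 0 < δ := lt_min hρ0 (by positivity)
  have hδρ : δ ≤ ρ := min_le_left _ _
  have hlamz : ∀ z : ℂ, ‖z‖ < δ → lam * ‖z‖ < 1 := by
    intro z hz
    have h1 : ‖z‖ < 1 / (lam + 1) := hz.trans_le (min_le_right _ _)
    rw [lt_div_iff₀ (by positivity)] at h1
    nlinarith [norm_nonneg z]
  refine ⟨δ, hδ0, frobeniusSol M (fun _ => 0) R v₀, fun z hz => ?_, by rw [hV0], fun z hz => ?_⟩
  · rw [mem_ball, dist_zero_right] at hz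
    exact ((hball z (hlamz z hz)).2.1).differentiableWithinAt
  rw [mem_ball, dist_zero_right] at hz
  obtain ⟨-, -, hode, -⟩ := hball z (hlamz z hz)
  rw [hode, tsum_congr (fun k => smul_zero (z ^ k)), tsum_zero, add_zero]
  -- identify `(Σ zᵏ • Mₖ) (V z)` with `E(z) V(z)`
  have hzρ : ‖z‖ < ρ := hz.trans_le hδρ
  have hT : Summable fun k => z ^ k • M k := by
    refine (summable_norm_pow_smul hMnorm ha0 ?_).of_norm
    have : a ≤ lam := hF.a_le_lam.2
    nlinarith [hlamz z hz, norm_nonneg z]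
  have key : ∀ v : ℂ × ℂ, (∑' k, z ^ k • M k) v = (e₁₁ z * v.1 + e₁₂ z * v.2, e₂₁ z * v.1 + e₂₂ z * v.2) := by
    intro v
    have h1 : HasSum (fun k => (z ^ k • M k) v) ((∑' k, z ^ k • M k) v) := by
      simpa only [ContinuousLinearMap.apply_apply] using (ContinuousLinearMap.apply ℂ (ℂ × ℂ) v).hasSum hT.hasSum
    have e₁ := hs₁ z (hzρ.trans_le (min_le_of_left_le (min_le_left _ _)))
    have e₂ := hs₂ z (hzρ.trans_le (min_le_of_left_le (min_le_right _ _)))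
    have e₃ := hs₃ z (hzρ.trans_le (min_le_of_right_le (min_le_left _ _)))
    have e₄ := hs₄ z (hzρ.trans_le (min_le_of_right_le (min_le_right _ _)))
    have h2 : HasSum (fun k => (z ^ k • M k) v) (e₁₁ z * v.1 + e₁₂ z * v.2, e₂₁ z * v.1 + e₂₂ z * v.2) := by
      have h := ((e₁.mul_right v.1).add (e₂.mul_right v.2)).prodMk ((e₃.mul_right v.1).add (e₄.mul_right v.2))
      refine h.congr_fun fun k => ?_
      rw [smul_apply, hMv, Prod.smul_mk, smul_eq_mul, smul_eq_mul]
      refine Prod.ext ?_ ?_ <;> simp only [smul_eq_mul] <;> ring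
    exact h1.unique h2
  exact key _

end Summit.AtomisticToContinuum.HydrodynamicLimit.Theorems.SonicCavityRenewal

end
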